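import Summits.ResolutionOfSingularities.ResolutionOfSingularities.Theorems.FrobeniusLadderFInjectiveMacaulayficationProp44OfOrderReducible
import Summits.ResolutionOfSingularities.ResolutionOfSingularities.Theorems.MarkedTransferCampaignW46ThreefoldsTauThreeSlice
import Literature.AlgebraicGeometry.Resolution.CurveGenericChainTermination
import Literature.AlgebraicGeometry.Resolution.CurveCentreNearPointUnique
import Literature.AlgebraicGeometry.Resolution.BlowupAxialPoint
import Literature.AlgebraicGeometry.Resolution.BlowupChartRegular
import Literature.AlgebraicGeometry.Resolution.BlowupsIntegral
import HarnessLib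

/-!
# [CoP1] Prop. 4.4 (`CossartPiltant2008_prop44`, F-71): the slice «`Σ` is a finite set of closed points of LOCAL DIMENSION TWO»
# (gap G5 of the inputs cell), in the W4.6 currency and at the fact's own quantifiers

[L1 W4.5a · crux `FInjectiveMacaulayfication` (stmt-ResolutionOfSingularities-15315); D-0154 (2) RES inputs cell, seat res-inputs-p-8b («G5»,
`plan/inputs/F71-CENSUS-p8b-notes.md` §3). PROVED, fact-free, definition-free; nothing of the manuscript under adjudication is used.]

`CossartPiltant2008_prop44` quantifies over ALL regular excellent integral Noetherian threefolds `S`; on a non-Jacobson `S` (e.g.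
`Spec ℤ_p[x, y]`) a Cossart–Piltant stage may have CLOSED points `x` of local dimension `2` in `Σ = {ord J = μ}` (isolated maximal points of
`V(J)`, `J_x` `𝔪_x`-primary). The W4.6 slices treat closed points of embedding dimension `3` only. Here such points are settled by the
SURFACE mechanism of [CoP1] p. 10 / Zariski–Samuel App. 5 already in the tree (`IsBlowup.colength_weakTransform_lt`,
`CurveGenericChainTermination.lean`) read at a CLOSED point, with res-inputs-p-8a's Lemma 4.3 (4) (`IsBlowup.eq_of_isNear_of_isNear_curve`,
`IsBlowup.isClosed_singleton_of_isNear_curve`, `CurveCentreNearPointUnique.lean`): blow up the reduced finite set of bad points at once;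
every bad point of the weak transform is the UNIQUE near point over an old one, closed, again of embedding dimension `2`, of STRICTLY
SMALLER colength; induction on the maximal colength.

* private helpers (the `e = 0` case of p-8a's announced `CurveCentreNearPointDimension` brick, by a height count): a near point over a
  point of embedding dimension `2` has a local ring of dimension `2` (`(0) ⊊ (c_j) ⊊ 𝔴` in the chart ring, `B_j/(c_j) ≅ k[T]` by the
  tree's `chartQuotEquiv` (Stacks 0BIQ), `IsBlowup.ringKrullDim_stalk_le`);
* `orderReducible_of_finite_dimTwo` — **THE G5 SLICE** (W4.6 currency);
* `prop44_conclusion_of_finite_dimTwo` — the same AT THE QUANTIFIERS OF `CossartPiltant2008_prop44`, via the dictionary (p611578).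

Not covered: `τ = 1` threefold points, curves of `Σ`, mixed configurations. `CossartPiltant2008_prop44` itself is NOT proved; resolution in
dimension `≥ 4` / positive characteristic is NOT proved. AI-written; AI review is weaker than expert review.

References: Cossart–Piltant, J. Algebra 320 (2008), Lemma 4.3 (4), Prop. 4.4 [CossartPiltant2008]; Zariski–Samuel II App. 5 Thm. 3
[ZariskiSamuel1960]; Huneke–Swanson (2006) Lemma 14.3.4 [HunekeSwanson2006]; Stacks 0BIQ, 01J7 [StacksProject]. -/
-- `Summit.<Summit>.<Sub>.Theorems` with `Sub = Summit` (single-conjunct summit, D-0017)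
set_option linter.dupNamespace false

noncomputable section

open CategoryTheory AlgebraicGeometry TopologicalSpace IsLocalRing
open Literature.AlgebraicGeometry.Resolution Scheme.IdealSheafData

namespace Summit.ResolutionOfSingularities.ResolutionOfSingularities.Theorems

namespace CP2008Prop44

universe u

/-! ## Private helpers: near points over a point of embedding dimension two -/

/-- A regular system of parameters is an `IsRsopPart` family (`e = 0`). [cite: Matsumura1987, Thm. 14.2] -/
private theorem isRsopPart_of_span_eq_maximalIdeal {R : Type u} [CommRing R] [IsRegularLocalRing R] {n : ℕ} (c : Fin n → R)
    (hc : Ideal.span (Set.range c) = maximalIdeal R) (hd : (maximalIdeal R).spanFinrank = n) : IsRsopPart c := by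
  refine ⟨inferInstance, 0, Fin.elim0, ?_, ?_⟩
  · have h := (isRegularLocalRing_iff R).mp inferInstance
    rw [hd] at h
    rw [← h]
    norm_num
  · have : Set.range (Fin.elim0 : Fin 0 → R) = ∅ := Set.range_eq_empty _
    rw [this, Set.union_empty, hc]

variable {X X' : Scheme.{u}} {π : X' ⟶ X}

set_option maxHeartbeats 400000 in
/-- The chart prime `𝔴` of a NEAR point over a point with `𝓘_{Y,x} = 𝔪_x = (c₀, c₁)` is maximal (tree `isMaximal_of_near`; packaging as in
`IsBlowup.residue_comp_stalkMap_surjective_of_isNear`). [cite: CossartPiltant2008, Lemma 4.3 (4)] -/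
private theorem isMaximal_chartPrime_of_isNear_dimTwo [IsLocallyNoetherian X] [IsLocallyNoetherian X']
    (hX : Scheme.IsRegular X) {Y : Closeds X} (hreg : Scheme.IsRegular (vanishingIdeal Y).subscheme)
    {J : X.IdealSheafData} {μ : ℕ} (hμ : 1 ≤ μ)
    (hY : ∀ y ∈ (Y : Set X), idealOrder J y = μ) {x' : X'} [IsRegularLocalRing (X.presheaf.stalk (π x'))]
    {c : Fin 2 → X.presheaf.stalk (π x')} (hcr : IsRsopPart c)
    (hcY : Ideal.span (Set.range c) = stalkIdeal (vanishingIdeal Y) (π x'))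
    (hnear : IsNear π (vanishingIdeal Y) J μ x') (j : Fin 2) (𝔴 : PrimeSpectrum (chartRing c j))
    (χ : chartRing c j →+* X'.presheaf.stalk x') (hχ : ∀ a, χ (chartBase c j a) = (π.stalkMap x').hom a)
    (hloc : @IsLocalization.AtPrime _ _ (X'.presheaf.stalk x') _ χ.toAlgebra 𝔴.asIdeal _)
    (h𝔴 : 𝔴.asIdeal.comap (chartBase c j) = maximalIdeal (X.presheaf.stalk (π x'))) :
    𝔴.asIdeal.IsMaximal := by
  classical
  have hx : π x' ∈ (Y : Set X) := by
    rw [← Scheme.IdealSheafData.coe_support_vanishingIdeal, SetLike.mem_coe, mem_support_iff_stalkIdeal_le, ← hcY]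
    exact hcr.span_range_le_maximalIdeal
  have hcm : ∀ i, c i ∈ maximalIdeal _ := hcr.mem_maximalIdeal
  have hcq : IsQuasiRegular c := by
    obtain ⟨e, z, hd, hz, hzc⟩ := hcr.exists_rsop
    have h := isQuasiRegular_rsop_comp hd z hz (Fin.castAdd e) (Fin.castAdd_injective 2 e)
    rwa [show z ∘ Fin.castAdd e = c from funext hzc] at h
  have h𝔴' : (maximalIdeal _).map (chartBase c j) ≤ 𝔴.asIdeal := by
    rw [← h𝔴]
    exact Ideal.map_comap_le
  obtain ⟨l, hl⟩ : ∃ l : Fin 2, l ≠ j := ⟨j + 1, by fin_cases j <;> decide⟩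
  -- a form `F` of degree `μ` with `F(c) ∈ J_x` and `F̄ ≠ 0` (`ord_x J = μ`, `J_x ⊆ P^μ`)
  have hJP : stalkIdeal J (π x') ≤ Ideal.span (Set.range c) ^ μ := by
    rw [hcY, ← stalkIdeal_pow]
    exact stalkIdeal_mono (le_vanishingIdeal_pow_of_forall_idealOrder_eq hX hreg hY) _
  have hJnot : ¬ stalkIdeal J (π x') ≤ maximalIdeal _ ^ (μ + 1) := by
    rw [← le_idealOrder_iff, hY (π x') hx]
    exact_mod_cast Nat.not_succ_le_self μ
  obtain ⟨f, hfJ, hf'⟩ := Set.not_subset.mp hJnot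
  obtain ⟨F, hF, hFf⟩ := exists_isHomogeneous_of_mem_span_pow c μ (hJP hfJ)
  have hF0 : MvPolynomial.map (residue _) F ≠ 0 :=
    map_residue_ne_zero_of_eval_not_mem_pow_succ c hcm hF (by rw [hFf]; exact hf')
  have hFJ : MvPolynomial.eval c F ∈ stalkIdeal J (π x') := by
    rw [hFf]
    exact hfJ
  have hnearF := algebraMap_eval₂Hom_mem_pow_of_isNear hcY j 𝔴 χ hχ hloc hnear hF hFJ
  exact isMaximal_of_near c j hl hcq hcm hμ hF hF0 𝔴.asIdeal h𝔴' hnearF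

/-- `(c_j) ⊂ B_j = R[𝔪/c_j]` is prime and not maximal: `B_j/(c_j) ≅ (R/𝔪)[T_l : l ≠ j]` (`chartQuotEquiv`). [cite: StacksProject, Tag 0BIQ] -/
private theorem isPrime_and_not_isMaximal_span_chartBase {R : Type u} [CommRing R] [IsRegularLocalRing R] {n : ℕ}
    (c : Fin (n + 2) → R) (hc : Ideal.span (Set.range c) = maximalIdeal R)
    (hd : (maximalIdeal R).spanFinrank = n + 2) (j : Fin (n + 2)) :
    (Ideal.span {chartBase c j (c j)}).IsPrime ∧ ¬ (Ideal.span {chartBase c j (c j)}).IsMaximal := by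
  classical
  have hcr : IsRsopPart c := isRsopPart_of_span_eq_maximalIdeal c hc hd
  have hcq : IsQuasiRegular c := by
    obtain ⟨e, z, hd', hz, hzc⟩ := hcr.exists_rsop
    have h := isQuasiRegular_rsop_comp hd' z hz (Fin.castAdd e) (Fin.castAdd_injective (n + 2) e)
    rwa [show z ∘ Fin.castAdd e = c from funext hzc] at h
  haveI : (Ideal.span (Set.range c)).IsMaximal := by rw [hc]; infer_instance
  -- `B_j/(c_j) ≅ k[T]`, a domain
  let e := chartQuotEquiv c j hcq
  haveI : IsDomain (chartRing c j ⧸ Ideal.span {chartBase c j (c j)}) := e.symm.toMulEquiv.isDomain _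
  refine ⟨(Ideal.Quotient.isDomain_iff_prime _).mp inferInstance, fun hmax => ?_⟩
  -- not a field: `T_l` is not a unit
  have hfield : IsField (chartRing c j ⧸ Ideal.span {chartBase c j (c j)}) :=
    (Ideal.Quotient.maximal_ideal_iff_isField_quotient _).mp hmax
  have hfield' : IsField (MvPolynomial {l : Fin (n + 2) // l ≠ j} (R ⧸ Ideal.span (Set.range c))) :=
    MulEquiv.isField hfield e.toMulEquiv
  obtain ⟨l, hl⟩ : ∃ l : Fin (n + 2), l ≠ j := by
    by_cases hj : j = 0
    · exact ⟨⟨1, by omega⟩, fun h => by rw [hj] at h; exact absurd (congrArg Fin.val h) (by simp)⟩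
    · exact ⟨0, fun h => hj h.symm⟩
  letI := hfield'.toField
  have hXu : IsUnit (MvPolynomial.X (R := R ⧸ Ideal.span (Set.range c)) (⟨l, hl⟩ : {l : Fin (n + 2) // l ≠ j})) :=
    isUnit_iff_ne_zero.mpr (MvPolynomial.X_ne_zero _)
  have h1 := (MvPolynomial.isUnit_iff_totalDegree_of_isReduced.mp hXu).2
  rw [MvPolynomial.totalDegree_X] at h1
  exact one_ne_zero h1

set_option maxHeartbeats 400000 in
/-- A near point over a point of embedding dimension `2` (`𝓘_{Y,x} = 𝔪_x`) has `dim 𝒪_{X',x'} = 2`: `ht 𝔴 ≥ 2` from `(0) ⊊ (c_j) ⊊ 𝔴`, and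
`dim 𝒪_{X',x'} ≤ dim 𝒪_{X,x} = 2` (`IsBlowup.ringKrullDim_stalk_le`). [cite: CossartPiltant2008, Lemma 4.3 (4)] [cite: StacksProject, Tag 0BIQ] -/
private theorem ringKrullDim_stalk_eq_two_of_isNear [IsIntegral X] [IsLocallyNoetherian X] [IsLocallyNoetherian X']
    (hX : Scheme.IsRegular X) {Y : Closeds X} (hreg : Scheme.IsRegular (vanishingIdeal Y).subscheme)
    (hπ : IsBlowup π (vanishingIdeal Y)) {J : X.IdealSheafData} {μ : ℕ} (hμ : 1 ≤ μ)
    (hY : ∀ y ∈ (Y : Set X), idealOrder J y = μ) {x' : X'} [IsRegularLocalRing (X.presheaf.stalk (π x'))]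
    (hd : (maximalIdeal (X.presheaf.stalk (π x'))).spanFinrank = 2)
    (hYx : stalkIdeal (vanishingIdeal Y) (π x') = maximalIdeal (X.presheaf.stalk (π x')))
    (hnear : IsNear π (vanishingIdeal Y) J μ x') :
    ringKrullDim (X'.presheaf.stalk x') = 2 := by
  classical
  -- a regular system of parameters `c = (c₀, c₁)`
  obtain ⟨c, hc⟩ : ∃ c : Fin 2 → X.presheaf.stalk (π x'), Ideal.span (Set.range c) = maximalIdeal _ := by
    obtain ⟨c₀, hc₀⟩ := exists_regularSystemOfParameters (R := X.presheaf.stalk (π x'))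
    let c : Fin 2 → X.presheaf.stalk (π x') := fun i => c₀ (i.cast hd.symm)
    have hrange : Set.range c = Set.range c₀ := by
      ext a
      constructor
      · rintro ⟨i, rfl⟩; exact ⟨i.cast hd.symm, rfl⟩
      · rintro ⟨i, rfl⟩; exact ⟨i.cast hd, by simp [c]⟩
    exact ⟨c, by rw [hrange, hc₀]⟩
  have hcr : IsRsopPart c := isRsopPart_of_span_eq_maximalIdeal c hc hd
  have hcY : Ideal.span (Set.range c) = stalkIdeal (vanishingIdeal Y) (π x') := by rw [hc, hYx]
  have hRdim : ringKrullDim (X.presheaf.stalk (π x')) = 2 := by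
    have h := (isRegularLocalRing_iff _).mp (inferInstance : IsRegularLocalRing (X.presheaf.stalk (π x')))
    rw [hd] at h
    exact_mod_cast h.symm
  -- the chart presentation `𝒪_{X',x'} = (B_j)_𝔴` and the maximality of `𝔴`
  obtain ⟨j, 𝔴, χ, hχ, hloc, h𝔴⟩ := hπ.exists_reesChart_stalk x' c hcY
  haveI h𝔴max := isMaximal_chartPrime_of_isNear_dimTwo hX hreg hμ hY hcr hcY hnear j 𝔴 χ hχ hloc h𝔴
  -- the prime `(c_j) ⊊ 𝔴` of height `≥ 1`
  haveI : IsNoetherianRing (chartRing c j) := isNoetherianRing_blowupChart c j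
  obtain ⟨hKp, hKnm⟩ := isPrime_and_not_isMaximal_span_chartBase (n := 0) c hc hd j
  haveI := hKp
  have hKle : Ideal.span {chartBase c j (c j)} ≤ 𝔴.asIdeal := by
    rw [Ideal.span_singleton_le_iff_mem, ← Ideal.mem_comap, h𝔴]
    exact hcr.mem_maximalIdeal j
  have hKlt : Ideal.span {chartBase c j (c j)} < 𝔴.asIdeal :=
    lt_of_le_of_ne hKle fun h => hKnm (h ▸ h𝔴max)
  have h1 : (1 : ℕ∞) ≤ (Ideal.span {chartBase c j (c j)}).height :=
    Ideal.one_le_height_span_singleton_of_mem_nonZeroDivisors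
      (reesChartBase_mem_nonZeroDivisors (c j) (Ideal.mem_span_range_self (f := c) (x := j)))
  have h2 := Ideal.height_add_one_le_of_lt_of_isPrime hKlt
  have h𝔴2 : (2 : ℕ∞) ≤ 𝔴.asIdeal.height :=
    le_trans (by simpa [one_add_one_eq_two] using (add_le_add h1 (le_refl (1 : ℕ∞)))) h2
  -- `dim 𝒪_{X',x'} = ht 𝔴 ≥ 2`, and `≤ dim 𝒪_{X,x} = 2`
  letI := χ.toAlgebra
  haveI : IsLocalization.AtPrime (X'.presheaf.stalk x') 𝔴.asIdeal := hloc
  have hdimst : ringKrullDim (X'.presheaf.stalk x') = 𝔴.asIdeal.height :=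
    IsLocalization.AtPrime.ringKrullDim_eq_height 𝔴.asIdeal (X'.presheaf.stalk x')
  have hup : ringKrullDim (X'.presheaf.stalk x') ≤ 2 := hRdim ▸ hπ.ringKrullDim_stalk_le x'
  refine le_antisymm hup ?_
  rw [hdimst]
  have h := (WithBot.coe_le_coe.mpr h𝔴2 : ((2 : ℕ∞) : WithBot ℕ∞) ≤ (𝔴.asIdeal.height : WithBot ℕ∞))
  simpa using h

/-- … hence embedding dimension `2` when `𝒪_{X',x'}` is regular. [cite: CossartPiltant2008, Lemma 4.3 (4)] -/
private theorem spanFinrank_eq_two_of_isNear [IsIntegral X] [IsLocallyNoetherian X] [IsLocallyNoetherian X']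
    (hX : Scheme.IsRegular X) {Y : Closeds X} (hreg : Scheme.IsRegular (vanishingIdeal Y).subscheme)
    (hπ : IsBlowup π (vanishingIdeal Y)) {J : X.IdealSheafData} {μ : ℕ} (hμ : 1 ≤ μ)
    (hY : ∀ y ∈ (Y : Set X), idealOrder J y = μ) {x' : X'} [IsRegularLocalRing (X.presheaf.stalk (π x'))]
    [IsRegularLocalRing (X'.presheaf.stalk x')]
    (hd : (maximalIdeal (X.presheaf.stalk (π x'))).spanFinrank = 2)
    (hYx : stalkIdeal (vanishingIdeal Y) (π x') = maximalIdeal (X.presheaf.stalk (π x')))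
    (hnear : IsNear π (vanishingIdeal Y) J μ x') :
    (maximalIdeal (X'.presheaf.stalk x')).spanFinrank = 2 := by
  have h := (isRegularLocalRing_iff _).mp (inferInstance : IsRegularLocalRing (X'.presheaf.stalk x'))
  rw [ringKrullDim_stalk_eq_two_of_isNear hX hreg hπ hμ hY hd hYx hnear] at h
  exact_mod_cast h


/-! ## The G5 slice -/

/-- `a < b ≤ N + 1` in `ℕ∞` gives `a ≤ N`. [folklore] -/
private theorem enat_le_of_lt_of_le_succ {a b : ℕ∞} {N : ℕ} (h1 : a < b) (h2 : b ≤ (N : ℕ∞) + 1) : a ≤ N := by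
  induction b using ENat.recTopCoe with
  | top => exact absurd h2 (by simp)
  | coe k =>
    induction a using ENat.recTopCoe with
    | top => exact absurd h1 (by simp)
    | coe j =>
      have hjk : j < k := by exact_mod_cast h1
      have hk : k ≤ N + 1 := by exact_mod_cast h2
      exact_mod_cast (by omega : j ≤ N)

set_option maxHeartbeats 800000 in
/-- The induction behind `orderReducible_of_finite_dimTwo`, on a bound for the colengths at the bad points. [cite: CossartPiltant2008, Prop. 4.4 (proof, p. 10)] -/
private theorem orderReducible_of_finite_dimTwo_aux (N : ℕ) :
    ∀ {X : Scheme.{u}} [IsIntegral X] [IsLocallyNoetherian X] (_hX : Scheme.IsRegular X) (J : X.IdealSheafData) {m : ℕ}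
      (_hm : 1 ≤ m) (_hle : ∀ x, idealOrder J x ≤ m) (T : Set X) (_hT : T.Finite) (_hTc : ∀ x ∈ T, IsClosed ({x} : Set X))
      (_hJT : ∀ x : X, (m : ℕ∞) ≤ idealOrder J x → x ∈ T) (_hord : ∀ x ∈ T, idealOrder J x = m)
      (_hdim : ∀ x ∈ T, (maximalIdeal (X.presheaf.stalk x)).spanFinrank = 2)
      (_hlen : ∀ x ∈ T, Module.length (X.presheaf.stalk x) (X.presheaf.stalk x ⧸ stalkIdeal J x) ≤ N),
      CampaignW46.OrderReducible J m := by
  induction N with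
  | zero =>
    intro X _ _ hX J m hm hle T hT hTc hJT hord hdim hlen
    -- no bad point: a bad point has `J_x ⊆ 𝔪_x`, so colength `≥ 1`
    refine CampaignW46.OrderReducible.of_forall_lt fun x => ?_
    by_contra hge
    rw [not_lt] at hge
    have hx := hJT x hge
    haveI := hX x
    have hJle : stalkIdeal J x ≤ maximalIdeal _ := by
      have h1 : stalkIdeal J x ≤ maximalIdeal _ ^ m := (le_idealOrder_iff J x m).mp (hord x hx).ge
      exact h1.trans (Ideal.pow_le_self (by omega))
    have hnt : Nontrivial (X.presheaf.stalk x ⧸ stalkIdeal J x) :=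
      Ideal.Quotient.nontrivial_iff.mpr (ne_top_of_le_ne_top (maximalIdeal.isMaximal _).ne_top hJle)
    have hpos : 0 < Module.length (X.presheaf.stalk x) (X.presheaf.stalk x ⧸ stalkIdeal J x) :=
      Module.length_pos_iff.mpr hnt
    have := hlen x hx
    exact absurd (lt_of_lt_of_le hpos this) (lt_irrefl _)
  | succ N ih =>
    intro X _ _ hX J m hm hle T hT hTc hJT hord hdim hlen
    classical
    by_cases hTe : ∀ x : X, idealOrder J x < m
    · exact CampaignW46.OrderReducible.of_forall_lt hTe
    simp only [not_forall, not_lt] at hTe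
    obtain ⟨x₀, hx₀⟩ := hTe
    have hx₀T : x₀ ∈ T := hJT x₀ hx₀
    let D : Closeds X := ⟨T, isClosed_of_finite_of_isClosed_singleton hT hTc⟩
    have hDreg : Scheme.IsRegular (vanishingIdeal D).subscheme := CampaignW46.isRegular_subscheme_vanishingIdeal_finite hT hTc
    have hDord : ∀ y ∈ (D : Set X), idealOrder J y = m := fun y hy => hord y hy
    have hDle : ∀ y ∈ (D : Set X), (m : ℕ∞) ≤ idealOrder J y := fun y hy => (hord y hy).ge
    have hJne : J ≠ ⊥ := by
      intro hJ
      have h := hord x₀ hx₀T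
      rw [hJ] at h
      haveI := hX x₀
      have hbot : stalkIdeal (⊥ : X.IdealSheafData) x₀ = ⊥ := by
        obtain ⟨U, hU, hxU, -⟩ :=
          exists_isAffineOpen_mem_and_subset (X := X) (x := x₀) (U := ⊤) (Opens.mem_top _)
        rw [stalkIdeal_eq_map_germ _ ⟨U, hU⟩ hxU, Scheme.IdealSheafData.ideal_bot, Pi.bot_apply, Ideal.map_bot]
      have : stalkIdeal (⊥ : X.IdealSheafData) x₀ ≤ maximalIdeal _ ^ (m + 1) := by
        rw [hbot]; exact bot_le
      have h2 := (le_idealOrder_iff (⊥ : X.IdealSheafData) x₀ (m + 1)).mpr this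
      rw [h] at h2
      exact absurd (by exact_mod_cast h2 : m + 1 ≤ m) (by omega)
    have hDne : vanishingIdeal D ≠ ⊥ := vanishingIdeal_ne_bot_of_forall_idealOrder_eq hJne hm hDord
    obtain ⟨X', π, hπ⟩ := exists_isBlowup X (vanishingIdeal D)
    haveI : IsLocallyNoetherian X' := hπ.isLocallyNoetherian
    haveI : IsIntegral X' := hπ.isIntegral hDne
    have hX' : Scheme.IsRegular X' :=
      ((CampaignW46.IsPermissibleBlowupSeq.single D π hDreg hDle hπ).isLocallyNoetherian_and_isRegular inferInstance hX).2
    set J' := controlledTransform π (vanishingIdeal D) J m with hJ'def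
    have hle' : ∀ z, idealOrder J' z ≤ m := hπ.idealOrder_controlledTransform_le_of_forall hX hDreg hDord hle
    -- the bad points of the transform lie over `T` and are near
    have hover : ∀ z : X', (m : ℕ∞) ≤ idealOrder J' z → π z ∈ T ∧ IsNear π (vanishingIdeal D) J m z := by
      intro z hz
      have hzT : π z ∈ T := by
        by_contra hnot
        have hns : π z ∉ ((vanishingIdeal D).support : Set X) := by
          rwa [Scheme.IdealSheafData.coe_support_vanishingIdeal]
        have h := hπ.idealOrder_controlledTransform_of_not_mem J m hns
        have hlt : idealOrder J (π z) < m := by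
          by_contra hge; rw [not_lt] at hge; exact hnot (hJT _ hge)
        rw [← h, ← hJ'def] at hlt
        exact absurd hz (not_le.mpr hlt)
      exact ⟨hzT, isNear_iff.mpr (le_antisymm (hle' z) hz)⟩
    -- at a point `x ∈ T`: a regular system of parameters `c = (c₀, c₁)` generating `𝓘_{D,x} = 𝔪_x`
    have hrsop : ∀ x ∈ T, haveI := hX x; ∃ c : Fin 2 → X.presheaf.stalk x,
        Ideal.span (Set.range c) = maximalIdeal _ ∧ IsRsopPart c ∧
          Ideal.span (Set.range c) = stalkIdeal (vanishingIdeal D) x := by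
      intro x hx
      haveI := hX x
      obtain ⟨c₀, hc₀⟩ := exists_regularSystemOfParameters (R := X.presheaf.stalk x)
      let c : Fin 2 → X.presheaf.stalk x := fun i => c₀ (i.cast (hdim x hx).symm)
      have hrange : Set.range c = Set.range c₀ := by
        ext a
        constructor
        · rintro ⟨i, rfl⟩; exact ⟨i.cast (hdim x hx).symm, rfl⟩
        · rintro ⟨i, rfl⟩; exact ⟨i.cast (hdim x hx), by simp [c]⟩
      have hc : Ideal.span (Set.range c) = maximalIdeal _ := by rw [hrange, hc₀]
      exact ⟨c, hc, isRsopPart_of_span_eq_maximalIdeal c hc (hdim x hx), by rw [hc, CampaignW46.stalkIdeal_vanishingIdeal_finite_eq_maximalIdeal hT hTc hx]⟩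
    let T' : Set X' := {z | (m : ℕ∞) ≤ idealOrder J' z}
    -- it is finite: at most one near point over each `x ∈ T` (Lemma 4.3 (4), res-inputs-p-8a's T2b)
    have hT'fin : T'.Finite := by
      refine (hT.biUnion (t := fun x => {z : X' | π z = x ∧ IsNear π (vanishingIdeal D) J m z}) fun x hx => ?_).subset ?_
      · refine Set.Subsingleton.finite fun z hz z' hz' => ?_
        obtain ⟨hzx, hzn⟩ := hz
        obtain ⟨hz'x, hz'n⟩ := hz'
        haveI := hX (π z)
        obtain ⟨c, -, hcr, hcY⟩ := hrsop (π z) (hzx ▸ hx)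
        exact (hπ.eq_of_isNear_of_isNear_curve hX hDreg hm hDord hcr hcY hzn hz'n (hz'x.trans hzx.symm)).symm
      · intro z hz
        obtain ⟨hzT, hzn⟩ := hover z hz
        exact Set.mem_biUnion hzT ⟨rfl, hzn⟩
    have hT'c : ∀ z ∈ T', IsClosed ({z} : Set X') := by
      intro z hz
      obtain ⟨hzT, hzn⟩ := hover z hz
      haveI := hX (π z)
      obtain ⟨c, -, hcr, hcY⟩ := hrsop (π z) hzT
      exact hπ.isClosed_singleton_of_isNear_curve hX hX' hDreg hm hDord (hTc _ hzT) hcr hcY hzn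
    have hord' : ∀ z ∈ T', idealOrder J' z = m := fun z hz => le_antisymm (hle' z) hz
    have hdim' : ∀ z ∈ T', (maximalIdeal (X'.presheaf.stalk z)).spanFinrank = 2 := by
      intro z hz
      obtain ⟨hzT, hzn⟩ := hover z hz
      haveI := hX (π z)
      haveI := hX' z
      exact spanFinrank_eq_two_of_isNear hX hDreg hπ hm hDord (hdim _ hzT)
        (CampaignW46.stalkIdeal_vanishingIdeal_finite_eq_maximalIdeal hT hTc hzT) hzn
    have hlen' : ∀ z ∈ T', Module.length (X'.presheaf.stalk z) (X'.presheaf.stalk z ⧸ stalkIdeal J' z) ≤ N := by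
      intro z hz
      obtain ⟨hzT, hzn⟩ := hover z hz
      haveI := hX (π z)
      have hfinx : IsFiniteLength (X.presheaf.stalk (π z)) (X.presheaf.stalk (π z) ⧸ stalkIdeal J (π z)) := by
        rw [← Module.length_ne_top_iff]
        exact ne_top_of_le_ne_top (by simp) (hlen _ hzT)
      have hlt := hπ.colength_weakTransform_lt hm hDord rfl (isNear_iff.mp hzn) (hX (π z)) (hdim _ hzT)
        (CampaignW46.stalkIdeal_vanishingIdeal_finite_eq_maximalIdeal hT hTc hzT) hfinx
      exact enat_le_of_lt_of_le_succ hlt (hlen _ hzT)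
    exact CampaignW46.OrderReducible.of_blowup D π hDreg hDle hπ
      (ih hX' J' hm hle' T' hT'fin hT'c (fun z hz => hz) hord' hdim' hlen')

/-- **THE G5 SLICE — [CoP1] Prop. 4.4 for a finite `Σ` of closed points of LOCAL DIMENSION TWO.** `X` regular, integral, locally
Noetherian; `J` an ideal sheaf, `m ≥ 1`, `ord_x J ≤ m` everywhere; every point of order `≥ m` in a finite set `T` of CLOSED points at each of
which `ord = m`, `emb.dim 𝒪_{X,x} = 2` and `𝒪_{X,x}/J_x` has finite length. Then `(X, J, m)` is ORDER-REDUCIBLE by permissible blowing-ups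
(blow up the reduced finite bad set repeatedly: each new bad point is the unique near point over an old one — Lemma 4.3 (4) —, closed, of
embedding dimension `2`, of smaller colength — Zariski–Samuel App. 5). [cite: CossartPiltant2008, Prop. 4.4 (proof, p. 10); Lemma 4.3 (4)]
[cite: ZariskiSamuel1960, Appendix 5, Thm. 3] -/
theorem orderReducible_of_finite_dimTwo {X : Scheme.{u}} [IsIntegral X] [IsLocallyNoetherian X] (hX : Scheme.IsRegular X)
    (J : X.IdealSheafData) {m : ℕ} (hm : 1 ≤ m) (hle : ∀ x, idealOrder J x ≤ m)
    (T : Set X) (hT : T.Finite) (hTc : ∀ x ∈ T, IsClosed ({x} : Set X))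
    (hJT : ∀ x : X, (m : ℕ∞) ≤ idealOrder J x → x ∈ T) (hord : ∀ x ∈ T, idealOrder J x = m)
    (hdim : ∀ x ∈ T, (maximalIdeal (X.presheaf.stalk x)).spanFinrank = 2)
    (hfin : ∀ x ∈ T, IsFiniteLength (X.presheaf.stalk x) (X.presheaf.stalk x ⧸ stalkIdeal J x)) :
    CampaignW46.OrderReducible J m := by
  classical
  -- a common bound for the (finite) colengths
  let ℓ : X → ℕ := fun x => (Module.length (X.presheaf.stalk x) (X.presheaf.stalk x ⧸ stalkIdeal J x)).toNat
  let N : ℕ := hT.toFinset.sup ℓ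
  refine orderReducible_of_finite_dimTwo_aux N hX J hm hle T hT hTc hJT hord hdim fun x hx => ?_
  have hne : Module.length (X.presheaf.stalk x) (X.presheaf.stalk x ⧸ stalkIdeal J x) ≠ ⊤ :=
    Module.length_ne_top_iff.mpr (hfin x hx)
  rw [← ENat.coe_toNat hne]
  exact_mod_cast Finset.le_sup (f := ℓ) (hT.mem_toFinset.mpr hx)

/-- **[CoP1] Prop. 4.4 on a Cossart–Piltant stage whose `Σ` is a finite set of closed points of local dimension `2`** (possible only over a
NON-JACOBSON base): the conclusion of `CossartPiltant2008_prop44` for this input, by `orderReducible_of_finite_dimTwo` and the dictionary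
`exists_isPermissibleSeq_of_orderReducible`. [cite: CossartPiltant2008, Prop. 4.4] -/
theorem prop44_conclusion_of_finite_dimTwo (S : Scheme.{u}) [IsIntegral S] [IsNoetherian S]
    (hS : Scheme.IsRegular S) (I : S.IdealSheafData)
    (X : Scheme.{u}) (ρ : X ⟶ S) [IsIntegral X] [IsNoetherian X] (hρ : IsRegularCentreBlowupSeq ρ I)
    (J : X.IdealSheafData) (μ : ℕ) (hμ : 1 ≤ μ) (hle : ∀ x, idealOrder J x ≤ μ)
    (T : Set X) (hT : T.Finite) (hTc : ∀ x ∈ T, IsClosed ({x} : Set X))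
    (hJT : ∀ x : X, (μ : ℕ∞) ≤ idealOrder J x → x ∈ T) (hord : ∀ x ∈ T, idealOrder J x = μ)
    (hdim : ∀ x ∈ T, (maximalIdeal (X.presheaf.stalk x)).spanFinrank = 2)
    (hfin : ∀ x ∈ T, IsFiniteLength (X.presheaf.stalk x) (X.presheaf.stalk x ⧸ stalkIdeal J x)) :
    ∃ (X' : Scheme.{u}) (π : X' ⟶ X) (J' : X'.IdealSheafData), IsPermissibleSeq π J μ J' ∧ ∀ x, idealOrder J' x < μ :=
  exists_isPermissibleSeq_of_orderReducible (hρ.isRegular hS) hle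
    (orderReducible_of_finite_dimTwo (hρ.isRegular hS) J hμ hle T hT hTc hJT hord hdim hfin)

end CP2008Prop44

end Summit.ResolutionOfSingularities.ResolutionOfSingularities.Theorems

end
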